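/-
Copyright (c) 2026 the pub-hodgecm-mathlib formalisation cell (harness21).  Prover seat hodgecm-mathlib-K2E2-p12 (g4): Track B «K2-LIT», ENGINE E1,
h413 = stmt-HodgeConjecture-24833; K2E1-plan (g4) «GO (q9) FILE 2 (b)» 2026-09-04T06:53:00Z, part (b2): the local norm compatibility along `K_v → L_w`.
-/
import Literature.NumberTheory.AdelicBaseChange.CompletionBaseChange                 -- ★ FLT packet: `Extension.adicCompletionSemialgHom`, `valued_adicCompletionSemialgHom` (`v_w(ι x) = v_v(x)^e`), `sum_ramification_inertia_extensions`
import Literature.NumberTheory.Automorphic.AddCharConductorExponent                    -- ★ `normAbs_eq_inv_zpow_of_valued_eq` (`‖x‖_v = q_v^{−ord}`), `exists_normAbs_eq_inv_zpow`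
import Literature.NumberTheory.Automorphic.AdicCompletionResidueCard                   -- ★ `residueFieldCard_adicCompletion_eq : q(K_v) = v.residueCard`
import Literature.NumberTheory.GaloisRepresentations.ArtinFormalismInductionProofs    -- ★ `residueCard_eq_pow_inertiaDeg_of_under_eq : w.residueCard = v.residueCard ^ f(w|v)`
import HarnessLib

/-!
# K2·E1 — `K2E1IntertwiningLocalFactorU2Height` (FILE 2 (b), part (b2)): THE LOCAL NORM COMPATIBILITY `‖ι_w x‖_w = ‖x‖_v^{e_w f_w}` along `K_v → L_w` (`w ∣ v`), and
# the MAX-FORM `∏_{w ∣ v} max(1, ‖ι_w x‖_w) = max(1, ‖x‖_v)^{[L:K]}` — the place-by-place identification behind the `U(J₂)` local factor `max(1, |t|_v)^{−2σ}`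

Track B ∕ K2-LIT, crux h413 = `stmt-HodgeConjecture-24833`, route of record `HCCMUnconditional`; cell `hodgecm-mathlib`, squad K2, ENGINE E1 (campaign «EIS-RANK-ONE», R7₂ FILE 2 (b)).
Dealer K2E1-plan (g4) «GO (q9) FILE 2 (b)» (06:53:00Z).  THEOREMS ONLY (no `def`, no instance, no notation, no named-fact hypothesis, no `sorry`; default heartbeats); lane
`--supports stmt-HodgeConjecture-24833 --as helper` (count-neutral).  GENERIC: any extension of number fields `L/K`, any finite place `v` of `K`, any `w ∣ v` (the FLT packet's
`v.Extension (𝓞 L) = {w // w.under (𝓞 K) = v}`, the SAME subtype as ★ `UnitaryGroup.PlacesOver L v`), `ι_w = Extension.adicCompletionSemialgHom K L w : K_v → L_w`.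

THE MATHEMATICS [NeukirchANT1999, Ch. II (4.8), (6.2); CasselsFrohlichANT1967, Ch. II §11 «‖b‖ = |b|^N»].  With the NORMALISED absolute values `‖·‖_v = q_v^{−ord_v}` (★ `normAbs`),
`ord_w(ι_w x) = e(w|v)·ord_v(x)` (★ `valued_adicCompletionSemialgHom`) and `q_w = q_v^{f(w|v)}` (★ `residueCard_eq_pow_inertiaDeg_of_under_eq` + ★ `residueFieldCard_adicCompletion_eq`) give
**`‖ι_w x‖_w = ‖x‖_v^{e(w|v) f(w|v)}`** (§1); hence `max(1, ‖ι_w x‖_w) = max(1, ‖x‖_v)^{e f}` and, by `Σ_{w∣v} e(w|v) f(w|v) = [L:K]` (★ `Ideal.sum_ramification_inertia_extensions`),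
**`∏_{w∣v} max(1, ‖ι_w x‖_w) = max(1, ‖x‖_v)^{[L:K]}`** (§2) — NO case split by place type (inert ∕ ramified ∕ split all read the same).  For the CM quadratic `L/L⁺` of the E1 line
(`[L:L⁺] = 2`) this is `max(1, |t|_v)²`, i.e. `(∏_{w∣v} max(1, |t|_w))^{−σ} = max(1, |t|_v)^{−2σ}` — the integrand of ★ FILE 2 (a) `K2E1IntertwiningLocalFactorU2` (§3).  Parts (b1)
(regrouping `∏ᶠ_w = ∏ᶠ_v ∏_{w∣v}`) and (b3) (the components of `θ t = t ⊗ δ`, `‖δ‖_w = 1` off `S_δ`) ride with FILE 3.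
HONEST LABEL: HC_CM is proved only modulo the 7 printed citations (2 remaining named inputs: hLiu418 = `stmt-HodgeConjecture-24832`, h413 = `stmt-HodgeConjecture-24833`) until rung 0
closes; this file asserts no named fact and closes no socket; count-neutral.

## References
* [NeukirchANT1999] J. Neukirch, *Algebraic Number Theory* (1999): Ch. II Thm. (4.8) (extension of absolute values), Prop. (6.2)∕(6.8) (`e f = [L_w:K_v]`, `Σ e f = n`).
* [CasselsFrohlichANT1967] J. W. S. Cassels, *Global fields*, in Cassels–Fröhlich (1967), Ch. II §11 (normalised valuations, «‖b‖ = |b|^N»).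
* [FLTProject2025] K. Buzzard et al., FLT project, `FLT/DedekindDomain/Completion/BaseChange.lean` (the typed `K_v → L_w`).
-/

set_option autoImplicit false
set_option linter.dupNamespace false -- the mandated namespace repeats `HodgeConjecture.HodgeConjecture`

noncomputable section

open NumberField IsDedekindDomain IsDedekindDomain.HeightOneSpectrum
open scoped NNReal
open Literature.NumberTheory.GaloisRepresentations.IsNonarchimedeanLocalField
open Literature.NumberTheory.Automorphic

namespace Summit.HodgeConjecture.HodgeConjecture.Cruxes.H413.K2E1IntertwiningLocalFactorU2Height

variable (K L : Type) [Field K] [NumberField K] [Field L] [NumberField L] [Algebra K L]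
  (v : HeightOneSpectrum (𝓞 K)) (w : v.Extension (𝓞 L))

/-! ## §1 `‖ι_w x‖_w = ‖x‖_v^{e(w|v)·f(w|v)}` -/

/-- `q_w = q_v^{f(w|v)}` for the residue cardinalities of the completions (★ `residueFieldCard_adicCompletion_eq` twice + ★ `residueCard_eq_pow_inertiaDeg_of_under_eq`).
[cite: NeukirchANT1999, Ch. II Prop. (6.2)] -/
theorem residueFieldCard_extension_eq_pow :
    residueFieldCard (w.1.adicCompletion L) = residueFieldCard (v.adicCompletion K) ^ w.1.asIdeal.inertiaDeg (𝓞 K) := by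
  rw [residueFieldCard_adicCompletion_eq, residueFieldCard_adicCompletion_eq]
  have hw : w.1.asIdeal.under (𝓞 K) = v.asIdeal := by
    have h := congrArg HeightOneSpectrum.asIdeal w.2
    rwa [HeightOneSpectrum.under_asIdeal] at h
  exact Literature.NumberTheory.GaloisRepresentations.residueCard_eq_pow_inertiaDeg_of_under_eq hw

/-- **THE LOCAL NORM COMPATIBILITY `‖ι_w x‖_w = ‖x‖_v^{e(w|v) f(w|v)}`** for the canonical `ι_w : K_v → L_w` (★ `Extension.adicCompletionSemialgHom`): `ord_w(ι_w x) = e·ord_v(x)`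
(★ `valued_adicCompletionSemialgHom`), `q_w = q_v^f`, and `‖·‖ = q^{−ord}` (★ `normAbs_eq_inv_zpow_of_valued_eq`). [cite: NeukirchANT1999, Ch. II Thm. (4.8), Prop. (6.2)]
[cite: CasselsFrohlichANT1967, Ch. II §11] -/
theorem normAbs_adicCompletionSemialgHom (x : v.adicCompletion K) :
    normAbs (w.1.adicCompletion L) (Extension.adicCompletionSemialgHom K L w x) =
      normAbs (v.adicCompletion K) x ^ (w.1.asIdeal.ramificationIdx (𝓞 K) * w.1.asIdeal.inertiaDeg (𝓞 K)) := by
  set e := w.1.asIdeal.ramificationIdx (𝓞 K) with he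
  set f := w.1.asIdeal.inertiaDeg (𝓞 K) with hf
  by_cases hx : x = 0
  · -- `e f ≠ 0`
    have he0 : e ≠ 0 := HeightOneSpectrum.ramificationIdx_ne_zero (𝓞 K) (𝓞 L)
      (algebraMap_injective_of_field_isFractionRing (𝓞 K) (𝓞 L) K L) w.1
    haveI := w.1.isPrime
    have hf0 : f ≠ 0 := (Ideal.inertiaDeg_pos (R := 𝓞 K) w.1.asIdeal).ne'
    rw [hx, map_zero, map_zero, map_zero, zero_pow (mul_ne_zero he0 hf0)]
  · -- `ord_v x = -n`
    have hv0 : Valued.v x ≠ 0 := (Valuation.ne_zero_iff _).2 hx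
    obtain ⟨n, hn⟩ : ∃ n : ℤ, Valued.v x = WithZero.exp n :=
      ⟨Multiplicative.toAdd (WithZero.unzero hv0), by rw [WithZero.exp, ofAdd_toAdd, WithZero.coe_unzero]⟩
    have hwn : Valued.v (Extension.adicCompletionSemialgHom K L w x) = WithZero.exp ((e : ℤ) • n) := by
      rw [Extension.valued_adicCompletionSemialgHom, hn, WithZero.exp_zsmul, zpow_natCast]
    rw [normAbs_eq_inv_zpow_of_valued_eq v hn, normAbs_eq_inv_zpow_of_valued_eq w.1 hwn, residueFieldCard_extension_eq_pow K L v w,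
      smul_eq_mul, Nat.cast_pow, ← zpow_natCast, ← zpow_natCast, inv_zpow', inv_zpow', ← zpow_mul, ← zpow_mul, neg_neg, neg_neg]
    congr 1
    push_cast
    ring

/-! ## §2 The max-form: `∏_{w ∣ v} max(1, ‖ι_w x‖_w) = max(1, ‖x‖_v)^{[L:K]}` -/

/-- `max(1, a^n) = max(1, a)^n` in `ℝ≥0`. [folklore] -/
theorem max_one_pow (a : ℝ≥0) (n : ℕ) : max 1 (a ^ n) = (max 1 a) ^ n := by
  rcases le_total a 1 with h | h
  · rw [max_eq_left (pow_le_one₀ (by positivity) h), max_eq_left h, one_pow]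
  · rw [max_eq_right (one_le_pow₀ h), max_eq_right h]

/-- **`max(1, ‖ι_w x‖_w) = max(1, ‖x‖_v)^{e(w|v) f(w|v)}`.** [cite: NeukirchANT1999, Ch. II Thm. (4.8)] -/
theorem max_one_normAbs_adicCompletionSemialgHom (x : v.adicCompletion K) :
    max 1 (normAbs (w.1.adicCompletion L) (Extension.adicCompletionSemialgHom K L w x)) =
      (max 1 (normAbs (v.adicCompletion K) x)) ^ (w.1.asIdeal.ramificationIdx (𝓞 K) * w.1.asIdeal.inertiaDeg (𝓞 K)) := by
  rw [normAbs_adicCompletionSemialgHom, max_one_pow]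

/-- **THE MAX-FORM OVER ALL `w ∣ v`: `∏_{w∣v} max(1, ‖ι_w x‖_w) = max(1, ‖x‖_v)^{[L:K]}`** (`Σ_{w∣v} e f = [L:K]`, ★ `Ideal.sum_ramification_inertia_extensions`; the finite type of
`w ∣ v` is ★ `Extension.fintype`).  No case split by place type.  [cite: NeukirchANT1999, Ch. II Prop. (6.8)] [cite: CasselsFrohlichANT1967, Ch. II §11] -/
theorem prod_extension_max_one_normAbs (x : v.adicCompletion K) :
    letI := Extension.fintype (𝓞 K) K L (𝓞 L) v
    ∏ w : v.Extension (𝓞 L), max 1 (normAbs (w.1.adicCompletion L) (Extension.adicCompletionSemialgHom K L w x)) =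
      (max 1 (normAbs (v.adicCompletion K) x)) ^ Module.finrank K L := by
  letI := Extension.fintype (𝓞 K) K L (𝓞 L) v
  simp_rw [max_one_normAbs_adicCompletionSemialgHom]
  rw [Finset.prod_pow_eq_pow_sum, Ideal.sum_ramification_inertia_extensions]

/-- **The same for the plain norms: `∏_{w∣v} ‖ι_w x‖_w = ‖x‖_v^{[L:K]}`** (the ONE-PLACE form of ★ `IdeleNormModule.finprod_norm_finiteIdeleConorm`).
[cite: CasselsFrohlichANT1967, Ch. II §11 Theorem] -/
theorem prod_extension_normAbs (x : v.adicCompletion K) :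
    letI := Extension.fintype (𝓞 K) K L (𝓞 L) v
    ∏ w : v.Extension (𝓞 L), normAbs (w.1.adicCompletion L) (Extension.adicCompletionSemialgHom K L w x) =
      normAbs (v.adicCompletion K) x ^ Module.finrank K L := by
  letI := Extension.fintype (𝓞 K) K L (𝓞 L) v
  simp_rw [normAbs_adicCompletionSemialgHom]
  rw [Finset.prod_pow_eq_pow_sum, Ideal.sum_ramification_inertia_extensions]

/-! ## §3 The CM quadratic case `[L:K] = 2`: `(∏_{w∣v} max(1, ‖ι_w t‖_w))^{−σ} = max(1, ‖t‖_v)^{−2σ}` — by token the integrand of ★ FILE 2 (a) `K2E1IntertwiningLocalFactorU2` -/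

/-- `[L:K] = 2` ⇒ `∏_{w∣v} max(1, ‖ι_w x‖_w) = max(1, ‖x‖_v)²`. [cite: NeukirchANT1999, Ch. II Prop. (6.8)] -/
theorem prod_extension_max_one_normAbs_of_finrank_eq_two (h2 : Module.finrank K L = 2) (x : v.adicCompletion K) :
    letI := Extension.fintype (𝓞 K) K L (𝓞 L) v
    ∏ w : v.Extension (𝓞 L), max 1 (normAbs (w.1.adicCompletion L) (Extension.adicCompletionSemialgHom K L w x)) =
      (max 1 (normAbs (v.adicCompletion K) x)) ^ 2 := by
  have h := prod_extension_max_one_normAbs K L v x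
  rwa [h2] at h

/-- **Real-exponent form** (`σ : ℝ`): `(∏_{w∣v} max(1, ‖ι_w x‖_w))^{−σ} = max(1, ‖x‖_v)^{−2σ}` — the integrand of ★ `K2E1IntertwiningLocalFactorU2.integral_max_one_normAbs_rpow_neg_two_mul`
by token. [cite: NeukirchANT1999, Ch. II Prop. (6.8)] -/
theorem coe_prod_extension_max_one_normAbs_rpow_neg_of_finrank_eq_two (h2 : Module.finrank K L = 2) (σ : ℝ) (x : v.adicCompletion K) :
    letI := Extension.fintype (𝓞 K) K L (𝓞 L) v
    ((∏ w : v.Extension (𝓞 L), max 1 (normAbs (w.1.adicCompletion L) (Extension.adicCompletionSemialgHom K L w x)) : ℝ≥0) : ℝ) ^ (-σ) =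
      (max 1 ((normAbs (v.adicCompletion K) x : ℝ≥0) : ℝ)) ^ (-(2 * σ)) := by
  rw [prod_extension_max_one_normAbs_of_finrank_eq_two K L v h2 x, NNReal.coe_pow, NNReal.coe_max, NNReal.coe_one,
    show (-(2 * σ) : ℝ) = ((2 : ℕ) : ℝ) * (-σ) by push_cast; ring, Real.rpow_mul (by positivity), Real.rpow_natCast]

/-- **Complex-exponent form** (`σ : ℂ`): `(∏_{w∣v} max(1, ‖ι_w x‖_w))^{−σ} = max(1, ‖x‖_v)^{−2σ}` — the integrand of ★ `K2E1IntertwiningLocalFactorU2.integral_max_one_normAbs_cpow_two_mul_adicCompletion`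
by token (the base is a positive real, so no branch issue). [cite: NeukirchANT1999, Ch. II Prop. (6.8)] -/
theorem coe_prod_extension_max_one_normAbs_cpow_neg_of_finrank_eq_two (h2 : Module.finrank K L = 2) (σ : ℂ) (x : v.adicCompletion K) :
    letI := Extension.fintype (𝓞 K) K L (𝓞 L) v
    (((∏ w : v.Extension (𝓞 L), max 1 (normAbs (w.1.adicCompletion L) (Extension.adicCompletionSemialgHom K L w x)) : ℝ≥0) : ℝ) : ℂ) ^ (-σ) =
      ((max 1 ((normAbs (v.adicCompletion K) x : ℝ≥0) : ℝ) : ℝ) : ℂ) ^ (-(2 * σ)) := by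
  rw [prod_extension_max_one_normAbs_of_finrank_eq_two K L v h2 x, NNReal.coe_pow, NNReal.coe_max, NNReal.coe_one, Complex.ofReal_pow]
  set m : ℝ := max 1 ((normAbs (v.adicCompletion K) x : ℝ≥0) : ℝ) with hm
  have hm0 : 0 ≤ m := by positivity
  have hlog : Complex.log (m : ℂ) * 2 = ((Real.log m * 2 : ℝ) : ℂ) := by
    rw [← Complex.ofReal_log hm0]; push_cast; ring
  have him : (Complex.log (m : ℂ) * 2).im = 0 := by rw [hlog, Complex.ofReal_im]
  rw [show (-(2 * σ) : ℂ) = 2 * (-σ) by ring, Complex.cpow_mul _ (by rw [him]; exact neg_lt_zero.2 Real.pi_pos) (by rw [him]; exact Real.pi_pos.le),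
    Complex.cpow_two]

end Summit.HodgeConjecture.HodgeConjecture.Cruxes.H413.K2E1IntertwiningLocalFactorU2Height

end
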